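import Summits.AnomalousDissipation.AnomalousDissipation.Theorems.SolenoidalFractalHomogenisationLagrangianStepSidebandPairKernel
import Summits.AnomalousDissipation.AnomalousDissipation.Theorems.SolenoidalFractalHomogenisationLagrangianStepSidebandPairSlot
import Summits.AnomalousDissipation.AnomalousDissipation.Theorems.SolenoidalFractalHomogenisationLagrangianStepSidebandDiagIdentity
import Summits.AnomalousDissipation.AnomalousDissipation.Theorems.SolenoidalFractalHomogenisationLagrangianStepCellChainLinks
import HarnessLib

/-!
# K1L_D `stub_D1_residueTail` (registry v17, stmt-AnomalousDissipation-27980) — lane A1 ASSEMBLY (case D): THE COLINEAR-SUCCESSOR ENTRY OF THE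
# PERIOD-MEAN FEEDBACK IS THE `pairResp` TERM PLUS THE IMAGE OF THE OLD STATE, EXACTLY (helper; `--supports stmt-AnomalousDissipation-27980`)

Summits-side helper file of route `SolenoidalFractalHomogenisation` (prover seat `ad-sawtooth-k1loc-p1` g13; lane A of the tail certificate
`Lines/onelevel-D1-tail-cert.md`, case D «colinear adjacent pair, forward orientation»).  Everything proved; no definitions, no named facts, no sorry.
For a word `W` with two consecutive slots `j'` (source) and `j` (pickup) sharing wave vector, phase and duration (`m_{j'} = mⱼ`, `φ_{j'} = φⱼ`, `τ_{j'} = τⱼ`,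
`startⱼ = start_{j'} + τ_{j'}`), a pre-stretch `M > 0`, `ν > 0`, `NearIso S lo hi` (`lo > 0`), `W₁ = (W.stretch M).stretch (1/ν)`, `𝔸 = ν•S`, `γ₁ = 1`,
`R = R0 ν`, `N = response W₁ 𝔸 1 R j'`, `±mⱼ` retained:
* `start_stretch_stretch_adj`, `slotAmp_eq_of_phase_eq` — bookkeeping of the doubly stretched word;
* `integral_pairFresh_eq` — the fresh–fresh pair kernel integrated over the pickup slot is `((4π²/ν)·P₁·slotCoef W j) • cmat(pairResp ρ Tⱼ B̂ⱼ · P̂ⱼ)`;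
* **`meanFeedback_pair_apply`** — for every `v ∈ ℂ³`:
  `M_{jj'} v = ((4π²/ν)·slotCoef W j) • cmat(pairResp W.ramp Tⱼ (regBlock S m̂ⱼ) · projPerp m̂ⱼ) v + (1/P₁) • ∫_{startⱼ}^{startⱼ+τ¹ⱼ} wrap_{jj'}(t) v dt`,
  `Tⱼ = 4π²|mⱼ|²Mτⱼ`, `wrap_{jj'}(t) v = 2πi envⱼ(t) • (αⱼ • exp((t−start_{j'})Bⱼ)(N start_{j'} v)_{−mⱼ} + ᾱⱼ • …_{mⱼ})` — i.e. `(ν/4π²)·M_{2l+1,2l}` is EXACTLY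
  `slotCoef_{2l} · (pairResp·P̂)_{2l}` (the `pairQS` term of `D1ResidueCert`, up to the sandwich `P̂·(·)·P̂`, immaterial on transversal data) plus the image of the
  state at the START of the source slot, which is `e^{−θ_{j'}}`-small at the pickup.
NOT a proof of any registered stub, of the crux, or of anomalous dissipation; rung leaf F-D1 infrastructure.
-/

set_option linter.dupNamespace false

noncomputable section

namespace Summit.AnomalousDissipation.AnomalousDissipation.Theorems.SolenoidalFractalHomogenisation.LagrangianStep.Sideband

open Set MeasureTheory Complex NormedSpace intervalIntegral
open scoped InnerProductSpace
open Literature.Analysis Literature.Analysis.FunctionSpaces Literature.Analysis.FunctionSpaces.Torus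
open Literature.Analysis.FluidPDE Literature.Analysis.FluidPDE.Torus Literature.Analysis.FluidPDE.LatticeShear
open Summit.AnomalousDissipation.AnomalousDissipation.Theorems.SolenoidalFractalHomogenisation.PermissibleCarrier
  (start_nonneg start_add_tau_le_period period_pos trapezoid_eq_zero_of_ge)
open Summit.AnomalousDissipation.AnomalousDissipation.Theorems.SolenoidalFractalHomogenisation.LagrangianStep.CellChain (start_stretch_stretch)
open Summit.AnomalousDissipation.AnomalousDissipation.Theorems.SolenoidalFractalHomogenisation.LagrangianStep.D1ResidueCert (pairResp)

variable {k₀ : ℕ}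

/-! ## §1 Bookkeeping of the doubly stretched word -/

/-- Adjacency transfers to the doubly stretched word: `start¹ⱼ = start¹_{j'} + τ¹_{j'}`. [folklore] -/
theorem start_stretch_stretch_adj (W : LatticeWord k₀) {M ν : ℝ} (hM : 0 < M) (hν : 0 < ν) {j j' : Fin k₀}
    (hadj : W.start j = W.start j' + (W.phase j').τ) :
    ((W.stretch M hM).stretch (1 / ν) (one_div_pos.mpr hν)).start j =
      ((W.stretch M hM).stretch (1 / ν) (one_div_pos.mpr hν)).start j' + (((W.stretch M hM).stretch (1 / ν) (one_div_pos.mpr hν)).phase j').τ := by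
  rw [start_stretch_stretch W hM hν j, start_stretch_stretch W hM hν j', tau_stretch_stretch W hM hν j', hadj]
  ring

/-- Slots with the same wave vector and phase have the same complex amplitude. [cite: MeshalkinSinai1961, pp. 1700–1705] -/
theorem slotAmp_eq_of_phase_eq (W₁ : LatticeWord k₀) {j j' : Fin k₀} (hmeq : (W₁.phase j').m = (W₁.phase j).m)
    (hφ : (W₁.phase j').φ = (W₁.phase j).φ) : slotAmp W₁ j' = slotAmp W₁ j := by
  rw [slotAmp_def, slotAmp_def, hmeq, hφ]

/-! ## §2 The fresh–fresh pair kernel integrated over the pickup slot -/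

/-- **THE FRESH–FRESH PAIR PART, INTEGRATED OVER THE PICKUP SLOT.**  With `W₁ = (W.stretch M).stretch (1/ν)`, consecutive slots `j'`, `j` of equal duration,
`Bⱼ = blockGen (ν•S) γ₁ mⱼ`:
`∫_{startⱼ}^{startⱼ+τ¹ⱼ} (8π²|αⱼ|² envⱼ(t)) • ∫_{start_{j'}}^{startⱼ} env_{j'}(u) • exp((t−u)Bⱼ)(P v) du dt = ((4π²/ν)·(M P_W/ν)·slotCoef W j) • cmat(pairResp ρ Tⱼ B̂ⱼ·P̂ⱼ) v`.
[cite: MajdaKramer1999, §2.2.1.3 (55) (effective diffusivity as a cell average)] [cite: Hale1980, Ch. III §1, Theorem 1.1] -/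
theorem integral_pairFresh_eq (W : LatticeWord k₀) {M ν : ℝ} (hM : 0 < M) (hν : 0 < ν) (S : Torus.Visc4 (Fin 3)) (γ₁ : ℝ) {j j' : Fin k₀}
    (hτ : (W.phase j').τ = (W.phase j).τ) (hadj : W.start j = W.start j' + (W.phase j').τ) (v : EuclideanSpace ℂ (Fin 3)) :
    let W₁ := (W.stretch M hM).stretch (1 / ν) (one_div_pos.mpr hν)
    ∫ t in W₁.start j..W₁.start j + (W₁.phase j).τ,
        (((8 * Real.pi ^ 2 * Complex.normSq (slotAmp W₁ j) * slotEnvelope W₁ j t : ℝ) : ℂ)) •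
          ∫ u in W₁.start j'..W₁.start j, ((slotEnvelope W₁ j' u : ℝ) : ℂ) •
            exp ((t - u) • (blockGen (ν • S) γ₁ (W₁.phase j).m).restrictScalars ℝ) (transversalProj (W₁.phase j).m v) =
      (((4 * Real.pi ^ 2 / ν) * (M * W.period / ν) * slotCoef W j : ℝ) : ℂ) •
        Matrix.toEuclideanCLM (n := Fin 3) (𝕜 := ℂ)
          ((pairResp W.ramp (4 * Real.pi ^ 2 * ‖latticeVec (W.phase j).m‖ ^ 2 * M * (W.phase j).τ) (regBlock S (mhat (W.phase j))) *
            projPerp (mhat (W.phase j))).map ((↑) : ℝ → ℂ)) v := by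
  intro W₁
  set t₀ := W₁.start j with ht₀
  set L := (W₁.phase j).τ with hLdef
  have hL : 0 < L := (W₁.phase j).τ_pos
  have hLval : L = M * (W.phase j).τ / ν := tau_stretch_stretch W hM hν j
  have hL' : (W₁.phase j').τ = L := by
    rw [hLdef, tau_stretch_stretch W hM hν j', tau_stretch_stretch W hM hν j, hτ]
  have hadj₁ : W₁.start j = W₁.start j' + (W₁.phase j').τ := start_stretch_stretch_adj W hM hν hadj
  have hs' : W₁.start j' = t₀ - L := by rw [ht₀, hadj₁, hL']; ring
  set Bℝ := (blockGen (ν • S) γ₁ (W₁.phase j).m).restrictScalars ℝ with hB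
  set Pv := transversalProj (W₁.phase j).m v with hPv
  set c : ℝ := 8 * Real.pi ^ 2 * Complex.normSq (slotAmp W₁ j) with hc
  obtain ⟨K, hK⟩ : ∃ K : ℝ → EuclideanSpace ℂ (Fin 3), K = fun σ => exp (σ • Bℝ) Pv := ⟨_, rfl⟩
  -- envelopes are plain trapezoids on their slots
  have henv : ∀ t ∈ Icc t₀ (t₀ + L), slotEnvelope W₁ j t = LatticeWord.trapezoid t₀ L W₁.ramp t :=
    fun t ht => slotEnvelope_eq_trapezoid_of_mem_Icc W₁ j ht
  have henv' : ∀ u ∈ Icc (t₀ - L) t₀, slotEnvelope W₁ j' u = LatticeWord.trapezoid (t₀ - L) L W₁.ramp u := by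
    intro u hu
    have hu' : u ∈ Icc (W₁.start j') (W₁.start j' + (W₁.phase j').τ) := by
      rw [hs', hL']; exact ⟨hu.1, by linarith [hu.2]⟩
    rw [slotEnvelope_eq_trapezoid_of_mem_Icc W₁ j' hu', hs', hL']
  rw [hs']
  have h1 : ∫ t in t₀..t₀ + L, (((c * slotEnvelope W₁ j t : ℝ) : ℂ)) • ∫ u in (t₀ - L)..t₀, ((slotEnvelope W₁ j' u : ℝ) : ℂ) • exp ((t - u) • Bℝ) Pv =
      c • ∫ t in t₀..t₀ + L, LatticeWord.trapezoid t₀ L W₁.ramp t •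
        ∫ u in (t₀ - L)..t₀, LatticeWord.trapezoid (t₀ - L) L W₁.ramp u • K (t - u) := by
    rw [← intervalIntegral.integral_smul]
    refine intervalIntegral.integral_congr fun t ht => ?_
    rw [uIcc_of_le (by linarith)] at ht
    show (((c * slotEnvelope W₁ j t : ℝ) : ℂ)) • ∫ u in (t₀ - L)..t₀, ((slotEnvelope W₁ j' u : ℝ) : ℂ) • exp ((t - u) • Bℝ) Pv =
      c • (LatticeWord.trapezoid t₀ L W₁.ramp t • ∫ u in (t₀ - L)..t₀, LatticeWord.trapezoid (t₀ - L) L W₁.ramp u • K (t - u))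
    rw [Complex.coe_smul, henv t ht, smul_smul]
    congr 1
    refine intervalIntegral.integral_congr fun u hu => ?_
    rw [uIcc_of_le (by linarith)] at hu
    show ((slotEnvelope W₁ j' u : ℝ) : ℂ) • exp ((t - u) • Bℝ) Pv = LatticeWord.trapezoid (t₀ - L) L W₁.ramp u • K (t - u)
    rw [Complex.coe_smul, henv' u hu, hK]
  have h2 := double_integral_pair_subst hL t₀ W₁.ramp K
  have hTL : L * (4 * Real.pi ^ 2 * ν * ‖latticeVec (W₁.phase j).m‖ ^ 2) ≠ 0 := by
    have := norm_latticeVec_pos (W₁.phase j); positivity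
  have h3 : ∫ u in (0:ℝ)..1, LatticeWord.trapezoid 0 1 W₁.ramp u • ∫ x in (0:ℝ)..1, LatticeWord.trapezoid 0 1 W₁.ramp x • K (L * (1 + u - x)) =
      ((L * (4 * Real.pi ^ 2 * ν * ‖latticeVec (W₁.phase j).m‖ ^ 2))⁻¹ : ℂ) •
        Matrix.toEuclideanCLM (n := Fin 3) (𝕜 := ℂ)
          ((pairResp W₁.ramp (L * (4 * Real.pi ^ 2 * ν * ‖latticeVec (W₁.phase j).m‖ ^ 2)) (regBlock S (mhat (W₁.phase j))) *
            projPerp (mhat (W₁.phase j))).map ((↑) : ℝ → ℂ)) v := by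
    rw [hK]
    exact pair_integral_integral_exp_blockGen_eq S ν γ₁ (W₁.phase j) W₁.ramp hTL v
  have hT : L * (4 * Real.pi ^ 2 * ν * ‖latticeVec (W₁.phase j).m‖ ^ 2) = 4 * Real.pi ^ 2 * ‖latticeVec (W.phase j).m‖ ^ 2 * M * (W.phase j).τ := by
    rw [hLval]
    show M * (W.phase j).τ / ν * (4 * Real.pi ^ 2 * ν * ‖latticeVec (W.phase j).m‖ ^ 2) = _
    field_simp
  have hQ : pairResp W₁.ramp (L * (4 * Real.pi ^ 2 * ν * ‖latticeVec (W₁.phase j).m‖ ^ 2)) (regBlock S (mhat (W₁.phase j))) *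
      projPerp (mhat (W₁.phase j)) =
      pairResp W.ramp (4 * Real.pi ^ 2 * ‖latticeVec (W.phase j).m‖ ^ 2 * M * (W.phase j).τ) (regBlock S (mhat (W.phase j))) *
        projPerp (mhat (W.phase j)) := by
    rw [hT]; rfl
  rw [show (fun t => (((8 * Real.pi ^ 2 * Complex.normSq (slotAmp W₁ j) * slotEnvelope W₁ j t : ℝ) : ℂ)) •
      ∫ u in (t₀ - L)..t₀, ((slotEnvelope W₁ j' u : ℝ) : ℂ) • exp ((t - u) • Bℝ) Pv) =
      fun t => (((c * slotEnvelope W₁ j t : ℝ) : ℂ)) • ∫ u in (t₀ - L)..t₀, ((slotEnvelope W₁ j' u : ℝ) : ℂ) • exp ((t - u) • Bℝ) Pv from rfl]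
  rw [h1, h2, h3, hQ]
  have hm : 0 < ‖latticeVec (W.phase j).m‖ := norm_latticeVec_pos (W.phase j)
  have hcval : c = 1 / (2 * ‖latticeVec (W.phase j).m‖ ^ 2) := by rw [hc]; exact eight_pi_sq_mul_normSq_slotAmp W₁ j
  have hP : 0 < W.period := period_pos W
  have hmm : ‖latticeVec (W₁.phase j).m‖ = ‖latticeVec (W.phase j).m‖ := rfl
  have hX : ((L : ℂ) * (4 * (Real.pi : ℂ) ^ 2 * (ν : ℂ) * ((‖latticeVec (W₁.phase j).m‖ : ℝ) : ℂ) ^ 2))⁻¹ =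
      ((((L * (4 * Real.pi ^ 2 * ν * ‖latticeVec (W₁.phase j).m‖ ^ 2))⁻¹ : ℝ)) : ℂ) := by
    push_cast; ring
  rw [hX]
  simp only [Complex.coe_smul, smul_smul]
  congr 1
  rw [hcval, hLval, hmm, slotCoef]
  have hν0 : ν ≠ 0 := hν.ne'
  have hM0 : M ≠ 0 := hM.ne'
  have hm0 : ‖latticeVec (W.phase j).m‖ ≠ 0 := hm.ne'
  have hP0 : W.period ≠ 0 := hP.ne'
  have hτ0 : (W.phase j).τ ≠ 0 := (W.phase j).τ_pos.ne'
  have hπ0 : Real.pi ≠ 0 := Real.pi_pos.ne'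
  field_simp
  ring

/-! ## §3 The colinear-successor entry of the period-mean feedback -/

/-- **THE COLINEAR-SUCCESSOR ENTRY OF THE PERIOD-MEAN FEEDBACK.**  For consecutive slots `j'` (source), `j` (pickup) with `m_{j'} = mⱼ`, `φ_{j'} = φⱼ`,
`τ_{j'} = τⱼ`; `W₁ = (W.stretch M).stretch (1/ν)`, `𝔸 = ν•S` (`NearIso S lo hi`, `lo > 0`), `γ₁ = 1`, `R = R0 ν`, `N = response W₁ 𝔸 1 R j'`, `±mⱼ` retained:
`M_{jj'} v = ((4π²/ν)·slotCoef W j) • cmat(pairResp W.ramp Tⱼ (regBlock S m̂ⱼ)·projPerp m̂ⱼ) v + (1/P₁) • ∫_{startⱼ}^{startⱼ+τ¹ⱼ} wrap_{jj'}(t) v dt` with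
`wrap_{jj'}(t) v = 2πi envⱼ(t) • (αⱼ • exp((t−start¹_{j'})Bⱼ)(N start¹_{j'} v)_{−mⱼ} + ᾱⱼ • exp((t−start¹_{j'})Bⱼ)(N start¹_{j'} v)_{mⱼ})`.
[cite: MajdaKramer1999, §2.2.1.3 (55) (effective diffusivity as a cell average)] [cite: Hale1980, Ch. III §1, Theorem 1.1] -/
theorem meanFeedback_pair_apply (W : LatticeWord k₀) {M ν : ℝ} (hM : 0 < M) (hν : 0 < ν) {S : Torus.Visc4 (Fin 3)} {lo hi : ℝ}
    (hS : Torus.NearIso S lo hi) (hlo : 0 < lo) {j j' : Fin k₀} (hmeq : (W.phase j').m = (W.phase j).m) (hφ : (W.phase j').φ = (W.phase j).φ)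
    (hτ : (W.phase j').τ = (W.phase j).τ) (hadj : W.start j = W.start j' + (W.phase j').τ)
    (hm : (W.phase j).m ∈ box (R0 ν)) (hm' : -(W.phase j).m ∈ box (R0 ν)) (v : EuclideanSpace ℂ (Fin 3)) :
    let W₁ := (W.stretch M hM).stretch (1 / ν) (one_div_pos.mpr hν)
    meanFeedback W₁ (ν • S) 1 (R0 ν) j j' v =
      (((4 * Real.pi ^ 2 / ν) * slotCoef W j : ℝ) : ℂ) • Matrix.toEuclideanCLM (n := Fin 3) (𝕜 := ℂ)
        ((pairResp W.ramp (4 * Real.pi ^ 2 * ‖latticeVec (W.phase j).m‖ ^ 2 * M * (W.phase j).τ) (regBlock S (mhat (W.phase j))) *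
          projPerp (mhat (W.phase j))).map ((↑) : ℝ → ℂ)) v +
      (1 / W₁.period) • ∫ t in W₁.start j..W₁.start j + (W₁.phase j).τ,
        (2 * Real.pi * Complex.I * ((slotEnvelope W₁ j t : ℝ) : ℂ)) •
          (slotAmp W₁ j • exp ((t - W₁.start j') • (blockGen (ν • S) 1 (W₁.phase j).m).restrictScalars ℝ)
              (coordL (R0 ν) (-(W₁.phase j).m) (response W₁ (ν • S) 1 (R0 ν) j' (W₁.start j') v)) +
            starRingEnd ℂ (slotAmp W₁ j) • exp ((t - W₁.start j') • (blockGen (ν • S) 1 (W₁.phase j).m).restrictScalars ℝ)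
              (coordL (R0 ν) (W₁.phase j).m (response W₁ (ν • S) 1 (R0 ν) j' (W₁.start j') v))) := by
  intro W₁
  have hN : IsPeriodicResponse W₁ (ν • S) 1 (R0 ν) j' (response W₁ (ν • S) 1 (R0 ν) j') :=
    isPeriodicResponse_response_psiStar W M hM hν hS hlo j'
  have hmeq₁ : (W₁.phase j').m = (W₁.phase j).m := hmeq
  have hα : slotAmp W₁ j' = slotAmp W₁ j := slotAmp_eq_of_phase_eq W₁ hmeq₁ hφ
  have hadj₁ : W₁.start j = W₁.start j' + (W₁.phase j').τ := start_stretch_stretch_adj W hM hν hadj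
  set N := response W₁ (ν • S) 1 (R0 ν) j' with hNdef
  set t₀ := W₁.start j with ht₀
  set s' := W₁.start j' with hs'
  set L := (W₁.phase j).τ with hLdef
  have hL : 0 < L := (W₁.phase j).τ_pos
  have h0 : 0 ≤ t₀ := start_nonneg W₁ j
  have h1P : t₀ + L ≤ W₁.period := start_add_tau_le_period W₁ j
  have hP : 0 < W₁.period := period_pos W₁
  set Bℝ := (blockGen (ν • S) 1 (W₁.phase j).m).restrictScalars ℝ with hB
  obtain ⟨tot, htot⟩ : ∃ f : ℝ → EuclideanSpace ℂ (Fin 3), f = fun t => feedback W₁ (R0 ν) j t (N t v) := ⟨_, rfl⟩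
  obtain ⟨fresh, hfresh⟩ : ∃ f : ℝ → EuclideanSpace ℂ (Fin 3), f = fun t =>
      (((8 * Real.pi ^ 2 * Complex.normSq (slotAmp W₁ j) * slotEnvelope W₁ j t : ℝ) : ℂ)) •
        ∫ u in s'..t₀, ((slotEnvelope W₁ j' u : ℝ) : ℂ) • exp ((t - u) • Bℝ) (transversalProj (W₁.phase j).m v) := ⟨_, rfl⟩
  obtain ⟨wrap, hwrap⟩ : ∃ f : ℝ → EuclideanSpace ℂ (Fin 3), f = fun t =>
      (2 * Real.pi * Complex.I * ((slotEnvelope W₁ j t : ℝ) : ℂ)) •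
        (slotAmp W₁ j • exp ((t - s') • Bℝ) (coordL (R0 ν) (-(W₁.phase j).m) (N s' v)) +
          starRingEnd ℂ (slotAmp W₁ j) • exp ((t - s') • Bℝ) (coordL (R0 ν) (W₁.phase j).m (N s' v))) := ⟨_, rfl⟩
  have hsplit : ∀ t ∈ Icc t₀ (t₀ + L), tot t = fresh t + wrap t := by
    intro t ht
    rw [htot, hfresh, hwrap]
    exact feedback_response_pair_eq_of_mem_slot W₁ (ν • S) 1 (R0 ν) hmeq₁ hα hadj₁ hN hm hm' v ht
  have htot_c : ContinuousOn tot (Icc t₀ (t₀ + L)) := by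
    rw [htot]
    have h := (continuousOn_feedback_comp W₁ (ν • S) 1 (R0 ν) j j' hN).mono (Icc_subset_Icc h0 h1P)
    have h' := h.clm_apply (continuousOn_const (c := v))
    refine h'.congr fun t _ => ?_
    simp only [ContinuousLinearMap.comp_apply, ContinuousLinearMap.coe_restrictScalars']
  have hEc : Continuous fun u : ℝ => exp (u • Bℝ) := continuous_iff_continuousAt.2 fun u => (hasDerivAt_exp_smul_const Bℝ u).continuousAt
  have henvc : Continuous fun s : ℝ => ((slotEnvelope W₁ j s : ℝ) : ℂ) := Complex.continuous_ofReal.comp (continuous_slotEnvelope W₁ j)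
  have hwrap_c : Continuous wrap := by
    rw [hwrap]
    refine ((continuous_const.mul henvc).smul ?_)
    exact ((((hEc.comp (continuous_id.sub continuous_const)).clm_apply continuous_const).const_smul (slotAmp W₁ j)).add
      (((hEc.comp (continuous_id.sub continuous_const)).clm_apply continuous_const).const_smul (starRingEnd ℂ (slotAmp W₁ j))))
  have hfresh_c : ContinuousOn fresh (Icc t₀ (t₀ + L)) := by
    have h : ∀ t ∈ Icc t₀ (t₀ + L), fresh t = tot t - wrap t := fun t ht => by rw [hsplit t ht, add_sub_cancel_right]
    exact (htot_c.sub hwrap_c.continuousOn).congr h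
  have hI_fresh : IntervalIntegrable fresh volume t₀ (t₀ + L) := hfresh_c.intervalIntegrable_of_Icc (by linarith)
  have hI_wrap : IntervalIntegrable wrap volume t₀ (t₀ + L) := hwrap_c.intervalIntegrable _ _
  have hMF : meanFeedback W₁ (ν • S) 1 (R0 ν) j j' v = (1 / W₁.period) • ∫ t in t₀..t₀ + L, tot t := by
    rw [meanFeedback_eq_slot_integral W₁ (ν • S) 1 (R0 ν) j j' ⟨_, hN⟩, _root_.smul_apply,
      ContinuousLinearMap.intervalIntegral_apply (intervalIntegrable_feedback_comp W₁ (ν • S) 1 (R0 ν) j j' hN h0 (by linarith) h1P) v]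
    congr 1
    refine intervalIntegral.integral_congr fun t _ => ?_
    rw [htot]
    simp only [ContinuousLinearMap.comp_apply, ContinuousLinearMap.coe_restrictScalars', hNdef]
  have hsum : ∫ t in t₀..t₀ + L, tot t = (∫ t in t₀..t₀ + L, fresh t) + ∫ t in t₀..t₀ + L, wrap t := by
    rw [← intervalIntegral.integral_add hI_fresh hI_wrap]
    refine intervalIntegral.integral_congr fun t ht => ?_
    rw [uIcc_of_le (by linarith)] at ht
    exact hsplit t ht
  have hF : ∫ t in t₀..t₀ + L, fresh t =
      (((4 * Real.pi ^ 2 / ν) * (M * W.period / ν) * slotCoef W j : ℝ) : ℂ) •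
        Matrix.toEuclideanCLM (n := Fin 3) (𝕜 := ℂ)
          ((pairResp W.ramp (4 * Real.pi ^ 2 * ‖latticeVec (W.phase j).m‖ ^ 2 * M * (W.phase j).τ) (regBlock S (mhat (W.phase j))) *
            projPerp (mhat (W.phase j))).map ((↑) : ℝ → ℂ)) v := by
    rw [hfresh]
    exact integral_pairFresh_eq W hM hν S 1 hτ hadj v
  rw [hMF, hsum, hF, smul_add, hwrap, period_stretch_stretch W hM hν]
  congr 1
  simp only [Complex.coe_smul, smul_smul]
  congr 1
  have hPW : W.period ≠ 0 := (period_pos W).ne'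
  have hν0 : ν ≠ 0 := hν.ne'
  have hM0 : M ≠ 0 := hM.ne'
  field_simp

end Summit.AnomalousDissipation.AnomalousDissipation.Theorems.SolenoidalFractalHomogenisation.LagrangianStep.Sideband

end
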